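import Literature.Topology.FourManifolds.SurfaceGroupAbelianisationKernels
import Literature.Algebra.Lie.SurfaceLieAlgebra
import HarnessLib

/-!
# Helper for `CongruenceShadows.AbelianShadowStandard` (item stmt-SmoothPoincare4-14599):
# the abelian shadow of the standard trisection is the coordinate Lagrangian triple

Route `SmoothPoincare4/CongruenceShadows`, support item `AbelianShadowStandard`.  One theorem,
`span_image_stabilizeIter`: the image in `H₁(S_{3+3m}) = ℤ^{2g}` (through
`SurfaceGroup.abelianize`) of the standard kernel `Nᵢ = (s4Kernels.stabilizeIter m) i` spans
the coordinate submodule on the cut system `s4CutSystem m i`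
(`Literature/Algebra/Lie/SurfaceLieAlgebra.lean`).  The cut normal form `Nᵢ = ⟪Cᵢ⟫` is the
tree theorem `stub_cutNormalForm`
(`Theorems/CongruenceShadowsNilpotentShadowsStandardStubCutNormalForm.lean`); its induction is
repeated here as local `have`s (letter transfer along handle relabellings, one stabilisation
step for an abstract target cut system) so that this file's import closure stays small, and
`SurfaceGroup.span_image_normalClosure` (conjugation is invisible in `H₁`) finishes.
-/

-- the prescribed namespace `Summit.<P>.<Sub>.…` duplicates `SmoothPoincare4` (P = Sub)
set_option linter.dupNamespace false

noncomputable section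

open Subgroup Multiplicative Literature.Topology.FourManifolds Literature.Algebra.Lie

namespace Summit.SmoothPoincare4.SmoothPoincare4.Theorems.AbelianShadowStandard

/-- **The abelian shadow of the standard kernels is the coordinate Lagrangian of the cut
system**: the image in `H₁ = ℤ^{2g}` of `Nᵢ = (s4Kernels.stabilizeIter m) i` spans the same
submodule as the coordinate vectors `δ_x`, `x ∈ s4CutSystem m i`.  Via the cut normal form
`Nᵢ = ⟪letters of s4CutSystem m i⟫` (proved here inline by the induction of
`Theorems/CongruenceShadowsNilpotentShadowsStandardStubCutNormalForm.lean`, `stub_cutNormalForm`,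
whose statement this file does not import: re-embedding and shifting letters along
`TrisectionKernels.stabilize`, the relabelling maps killing the relator modulo a normal subgroup
that meets every handle) and `SurfaceGroup.span_image_normalClosure`. [folklore] -/
theorem span_image_stabilizeIter (m : ℕ) (i : Fin 3) :
    Submodule.span ℤ ((fun s => toAdd (SurfaceGroup.abelianize (3 + 3 * m) s)) ''
        ((s4Kernels.stabilizeIter m i : Subgroup (SurfaceGroup (3 + 3 * m))) : Set _)) =
      Submodule.span ℤ ((fun y => (Pi.single y (1 : ℤ) : surfaceGen (3 + 3 * m) → ℤ)) ''
        s4CutSystem m i) := by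
  -- (1) letter transfer along a handle relabelling into a normal subgroup `N`
  have transfer : ∀ {n k : ℕ} (f : Fin n → Fin k) (C : Set (surfaceGen n))
      (N : Subgroup (SurfaceGroup k)), N.Normal →
      (∀ j : Fin n, (PresentedGroup.of (f j, false) : SurfaceGroup k) ∈ N ∨
        (PresentedGroup.of (f j, true) : SurfaceGroup k) ∈ N) →
      (∀ p ∈ C, (PresentedGroup.of (f p.1, p.2) : SurfaceGroup k) ∈ N) →
      ∀ x : FreeGroup (surfaceGen n),
        PresentedGroup.mk _ x ∈ normalClosure (PresentedGroup.of '' C : Set (SurfaceGroup n)) →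
        PresentedGroup.mk _ (FreeGroup.map (fun p : surfaceGen n => (f p.1, p.2)) x) ∈ N := by
    intro n k f C N hNn hN hC x hx
    haveI : N.Normal := hNn
    set Φ : FreeGroup (surfaceGen n) →* SurfaceGroup k ⧸ N :=
      (QuotientGroup.mk' N).comp ((PresentedGroup.mk _).comp
        (FreeGroup.map fun p : surfaceGen n => (f p.1, p.2))) with hΦ
    have hΦof : ∀ p : surfaceGen n, Φ (FreeGroup.of p) = 1 ↔
        (PresentedGroup.of (f p.1, p.2) : SurfaceGroup k) ∈ N := by
      intro p
      rw [hΦ, MonoidHom.comp_apply, MonoidHom.comp_apply, FreeGroup.map.of, QuotientGroup.mk'_apply,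
        QuotientGroup.eq_one_iff]
      rfl
    have hgen : ∀ j : Fin n, Φ (genA j) = 1 ∨ Φ (genB j) = 1 :=
      fun j => (hN j).imp (hΦof (j, false)).2 (hΦof (j, true)).2
    have hrel : ∀ r ∈ ({surfaceRelator n} : Set (FreeGroup (surfaceGen n))), Φ r = 1 := by
      intro r hr
      rw [Set.mem_singleton_iff] at hr
      rw [hr]
      change Φ (((List.finRange n).map fun i => genA i * genB i * (genA i)⁻¹ * (genB i)⁻¹).prod) = 1
      rw [map_list_prod, List.map_map]
      refine List.prod_eq_one fun y hy => ?_
      obtain ⟨j, -, rfl⟩ := List.mem_map.1 hy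
      rcases hgen j with h | h <;> simp [h]
    have hker : normalClosure (PresentedGroup.of '' C : Set (SurfaceGroup n)) ≤
        (presentedLift Φ hrel).ker := by
      refine normalClosure_le_normal ?_
      rintro _ ⟨p, hp, rfl⟩
      rw [SetLike.mem_coe, MonoidHom.mem_ker, presentedLift_of]
      exact (hΦof p).2 (hC p hp)
    have h := hker hx
    rw [MonoidHom.mem_ker, presentedLift_mk, hΦ, MonoidHom.comp_apply, MonoidHom.comp_apply,
      QuotientGroup.mk'_apply, QuotientGroup.eq_one_iff] at h
    exact h
  -- (2) one stabilisation step in cut normal form, for an abstract target cut system `C'`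
  have step : ∀ {g : ℕ} (C : Set (surfaceGen g)) (C₃ : Set (surfaceGen 3))
      (C' : Set (surfaceGen (g + 3))),
      (∀ p ∈ C, (Fin.castAdd 3 p.1, p.2) ∈ C') → (∀ p ∈ C₃, (Fin.natAdd g p.1, p.2) ∈ C') →
      (∀ q ∈ C', (∃ p ∈ C, (Fin.castAdd 3 p.1, p.2) = q) ∨ (∃ p ∈ C₃, (Fin.natAdd g p.1, p.2) = q)) →
      (∀ j : Fin (g + 3), (j, false) ∈ C' ∨ (j, true) ∈ C') →
      normalClosure (stabSet (↑(normalClosure (PresentedGroup.of '' C : Set (SurfaceGroup g))))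
          (↑(normalClosure (PresentedGroup.of '' C₃ : Set (SurfaceGroup 3))))) =
        normalClosure (PresentedGroup.of '' C' : Set (SurfaceGroup (g + 3))) := by
    intro g C C₃ C' ha hb hc hd
    have hN : ∀ q ∈ C', (PresentedGroup.of q : SurfaceGroup (g + 3)) ∈
        normalClosure (PresentedGroup.of '' C' : Set (SurfaceGroup (g + 3))) :=
      fun q hq => subset_normalClosure ⟨q, hq, rfl⟩
    apply le_antisymm
    · refine normalClosure_le_normal ?_
      rintro s (⟨x, hx, rfl⟩ | ⟨x, hx, rfl⟩)
      · exact transfer (Fin.castAdd 3) C _ inferInstance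
          (fun j => (hd (Fin.castAdd 3 j)).imp (hN _) (hN _)) (fun p hp => hN _ (ha p hp)) x hx
      · exact transfer (Fin.natAdd g) C₃ _ inferInstance
          (fun j => (hd (Fin.natAdd g j)).imp (hN _) (hN _)) (fun p hp => hN _ (hb p hp)) x hx
    · refine normalClosure_mono ?_
      rintro _ ⟨q, hq, rfl⟩
      rcases hc q hq with ⟨p, hp, rfl⟩ | ⟨p, hp, rfl⟩
      · refine Or.inl ⟨FreeGroup.of p, subset_normalClosure ⟨p, hp, rfl⟩, ?_⟩
        simp only [Function.comp_apply, genIncl_of]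
        rfl
      · refine Or.inr ⟨FreeGroup.of p, subset_normalClosure ⟨p, hp, rfl⟩, ?_⟩
        simp only [Function.comp_apply, genShift_of]
        rfl
  -- (3) the cut normal form `Nᵢ = ⟪letters of Cᵢ⟫`, by induction on `m`
  have hcut : ∀ m : ℕ, s4Kernels.stabilizeIter m i =
      normalClosure (PresentedGroup.of '' s4CutSystem m i : Set (SurfaceGroup (3 + 3 * m))) := by
    intro m
    induction m with
    | zero =>
      rw [s4CutSystem_zero]
      exact s4Kernels_eq i
    | succ m ih =>
      change (s4Kernels.stabilizeIter m).stabilize i = _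
      rw [TrisectionKernels.stabilize_apply, ih, s4Kernels_eq]
      have hsucc : ∀ (j : Fin (3 + 3 * m + 3)) (b : Bool),
          (j, b) ∈ (s4CutSystem (m + 1) i : Set (surfaceGen (3 + 3 * m + 3))) ↔
            ((⟨(j : ℕ) % 3, Nat.mod_lt _ (by decide)⟩ : Fin 3), b) ∈ s4Gens i := fun _ _ => Iff.rfl
      have hcast : ∀ (j : Fin (3 + 3 * m)) (b : Bool),
          (Fin.castAdd 3 j, b) ∈ (s4CutSystem (m + 1) i : Set (surfaceGen (3 + 3 * m + 3))) ↔
            (j, b) ∈ s4CutSystem m i := fun _ _ => Iff.rfl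
      have hshift : ∀ (j : Fin 3) (b : Bool),
          (Fin.natAdd (3 + 3 * m) j, b) ∈ (s4CutSystem (m + 1) i : Set (surfaceGen (3 + 3 * m + 3))) ↔
            (j, b) ∈ s4Gens i := by
        intro j b
        have hj : (3 + 3 * m + (j : ℕ)) % 3 = j := by have := j.is_lt; omega
        rw [hsucc]
        simp only [Fin.val_natAdd, hj, Fin.eta]
      refine step (s4CutSystem m i) ↑(s4Gens i) (s4CutSystem (m + 1) i) ?_ ?_ ?_ ?_
      · intro p hp
        exact (hcast p.1 p.2).2 hp
      · intro p hp
        exact (hshift p.1 p.2).2 hp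
      · rintro ⟨j, b⟩ hq
        induction j using Fin.addCases with
        | left j => exact Or.inl ⟨(j, b), (hcast j b).1 hq, rfl⟩
        | right j => exact Or.inr ⟨(j, b), (hshift j b).1 hq, rfl⟩
      · exact fun j => s4Gens_hits i _
  -- (4) pass to `H₁`
  rw [hcut m, SurfaceGroup.span_image_normalClosure, Set.image_image]
  simp only [SurfaceGroup.abelianize_of, toAdd_ofAdd]

end Summit.SmoothPoincare4.SmoothPoincare4.Theorems.AbelianShadowStandard

end
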